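import Summits.CriticalPhenomena.PercolationContinuityZ3.Theorems.PercNearOneGluingNoHeavyQuantFarSunTKFinalAllK
import Summits.CriticalPhenomena.PercolationContinuityZ3.Theorems.PercNearOneGluingNoHeavyQuantFarLayerOneUnicyclic
import Summits.CriticalPhenomena.PercolationContinuityZ3.Theorems.PercNearOneGluingNoHeavyQuantFarLayerOneTreeObserverAll
import HarnessLib

/-!
# QUANT lane R8, front "FAR beyond trees" — LAYER ONE OF FAR ON EVERY UNICYCLIC SUPPORT, UNCONDITIONALLY

builds on p205010 (kernel theorem, internal audit signed; external expert review pending)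

Support file (`--supports stmt-CriticalPhenomena-4575`), seat `prim-cert-1` (gen 23).  Assembly: gen 18's (seat `prim-quant-p1`) flattening
theorems `Quant.Bundle.layerOne_of_pforest_of_sunFAR` (observer on the cycle) and `Quant.Bundle.layerOne_of_pforest_treeObs_of_sunFAR`
(observer in a pendant tree) are conditional on `HairyCycle.SunFAR K 1` for all `K ≥ 2`; that hypothesis is now the theorem
`HairyCycle.sunFAR_one` (`…QuantFarSunTKFinalAllK`: the closed-form certificate `T_K` for `K ≥ 4`, the tabulated certificate `F₃`, `K = 2` vacuous).
* **`Quant.Bundle.layerOne_of_pforest_cycleObs`** — for every pendant forest on a cycle (`Bundle.PForest L cyc idx T par dep w`: every finite weighted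
  graph with unicyclic support, observer `c_0` on the cycle) and every relay set `A ⊆ T ∪ cycle`:
  `2 < Σ_{a∈A} P(c_0 ↔ a)` and `P(c_0 ↮ a) ≤ t` on `A` imply `P(#{a ∈ A : c_0 ↔ a} ≤ 1) ≤ t`.
* **`Quant.Bundle.layerOne_of_pforest_treeObs_all`** — the same for every observer `o` in a pendant tree (parent chain `o, par o, …, par^k o ∈ T`,
  `par^{k+1} o = c_0`).
Together: layer one (`j = 1`) of `Quant.FarRelayRow` holds at EVERY observer of EVERY finite weighted graph whose support is unicyclic.
No sorries; axioms as of `HairyCycle.sunFAR_one`.  [cite: KozmaNitzan2024, Conjecture 3 (p. 15)] (the row); [this work].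
-/

noncomputable section

namespace Summit.CriticalPhenomena.PercolationContinuityZ3.Theorems

namespace Quant

namespace Bundle

open Finset MeasureTheory Set
open Literature.Probability.LatticeModels
open Literature.Probability.Percolation
open Summit.CriticalPhenomena.PercolationContinuityZ3.Theorems.HairyCycle (SunFAR sunFAR_one)
open scoped Classical

variable {n : ℕ} {L : ℕ} {cyc : ℕ → Fin n} {idx : Fin n → ℕ}

/-- **Layer one of FAR on every unicyclic support, observer on the cycle** (unconditional): for a pendant forest on a cycle and relays
`A ⊆ T ∪ cycle`, `2 < Σ_{a∈A} P(c_0 ↔ a)` and `P(c_0 ↮ a) ≤ t` on `A` imply `P(#{a ∈ A : c_0 ↔ a} ≤ 1) ≤ t`. [this work] -/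
theorem layerOne_of_pforest_cycleObs {T : Finset (Fin n)} {par : Fin n → Fin n} {dep : Fin n → ℕ}
    {w : Sym2 (Fin n) → unitInterval} (P : PForest L cyc idx T par dep w) (A : Finset (Fin n))
    (hA : ∀ a ∈ A, a ∈ T ∨ ∃ i, i < L ∧ a = cyc i) (t : ℝ)
    (hEN : (2 : ℝ) < ∑ a ∈ A, (prodBernoulli w).real (openConn (cyc 0) a))
    (hcut : ∀ a ∈ A, (prodBernoulli w).real (openConn (cyc 0) a : Set (BondConfig (Fin n)))ᶜ ≤ t) :
    (prodBernoulli w).real {ω : BondConfig (Fin n) | (A.filter fun a => ω ∈ openConn (cyc 0) a).card ≤ 1} ≤ t :=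
  layerOne_of_pforest_of_sunFAR (fun _ hK => sunFAR_one hK) P A hA t hEN hcut

/-- **Layer one of FAR on every unicyclic support, observer in a pendant tree** (unconditional): for a pendant forest on a cycle, an
observer `o` whose parent chain `o, par o, …, par^k o` stays in `T` with `par^{k+1} o = c_0`, and relays `A ⊆ T ∪ cycle`:
`2 < Σ_{a∈A} P(o ↔ a)` and `P(o ↮ a) ≤ t` on `A` imply `P(#{a ∈ A : o ↔ a} ≤ 1) ≤ t`. [this work] -/
theorem layerOne_of_pforest_treeObs_all {T : Finset (Fin n)} {par : Fin n → Fin n} {dep : Fin n → ℕ}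
    {w : Sym2 (Fin n) → unitInterval} (P : PForest L cyc idx T par dep w) {o : Fin n} {k : ℕ} (hk : par^[k + 1] o = cyc 0)
    (hchain : ∀ j, j ≤ k → par^[j] o ∈ T) (A : Finset (Fin n)) (hA : ∀ a ∈ A, a ∈ T ∨ ∃ i, i < L ∧ a = cyc i) (t : ℝ)
    (hEN : (2 : ℝ) < ∑ a ∈ A, (prodBernoulli w).real (openConn o a))
    (hcut : ∀ a ∈ A, (prodBernoulli w).real (openConn o a : Set (BondConfig (Fin n)))ᶜ ≤ t) :
    (prodBernoulli w).real {ω : BondConfig (Fin n) | (A.filter fun a => ω ∈ openConn o a).card ≤ 1} ≤ t :=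
  layerOne_of_pforest_treeObs_of_sunFAR (fun _ hK => sunFAR_one hK) A (T.card + k) T par dep w o k P le_rfl hk hchain hA t hEN hcut

end Bundle

end Quant

end Summit.CriticalPhenomena.PercolationContinuityZ3.Theorems

end
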